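import Summits.AtomisticToContinuum.BoseEinsteinCondensation.Theses.BECDyadicChaining
import Literature.MathematicalPhysics.QuantumManyBody.DiluteBoseGasUpperBoundLocalization
import Literature.MathematicalPhysics.QuantumManyBody.BoseGasThermodynamicLimitRuelle
import HarnessLib

/-!
# Crux `DyadicCoherenceDefect` (stmt-AtomisticToContinuum-13192), line `registered` (lead c2, kinetic window):
# the registered stub `stub_kineticBudget` (E, KINETIC BUDGET OF NEAR-MINIMISERS)

Supports (does not close) stmt-AtomisticToContinuum-13192. For repulsive finite-range `v` with
`a = a(v) > 0` and every `μ > 0`: at all small densities `ρ`, eventually in `N`, every Dirichlet trial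
state `Ψ` in the box of side `(N/ρ)^{1/3}` with `⟨Ψ, H_N Ψ⟩ ≤ E₀ + 1` has kinetic energy
`∫ |∇Ψ|² ≤ 4π a ρ (1 + μ) N`.

Proof: the interaction is nonnegative, so `∫ |∇Ψ|² ≤ energy v Ψ ≤ E₀ + 1` (pointwise `le_self_add`
under the lower Lebesgue integral); Dyson's upper bound `eventually_groundStateEnergy_le_dyson` gives
`E₀ ≤ 4πρa(1 + C(ρa³)^{1/3})N` eventually in `N` for `ρ < ρ₀(v)`; shrinking `ρ₀` so that
`C (ρ a³)^{1/3} ≤ μ/2` (i.e. `ρ ≤ (μ/(2C))³/a³`) and taking `N ≥ 1/(2π a ρ μ)` (so that the slack `1`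
is `≤ 2π a ρ μ N`) yields `E₀ + 1 ≤ 4πaρ(1 + μ/2)N + 2πaρμN = 4π a ρ (1 + μ) N`. No new definitions.
-/

noncomputable section

open Filter MeasureTheory
open scoped ENNReal NNReal BigOperators

namespace Summit.AtomisticToContinuum.BoseEinsteinCondensation.Cruxes.DyadicCoherenceDefect.Birth

open Literature.MathematicalPhysics.QuantumManyBody.BoseGas
open Summit.AtomisticToContinuum.BoseEinsteinCondensation.Theses

/-- **Stub E (M): kinetic budget of near-minimisers** — see `KineticBudget`. For repulsive
finite-range `v` with `a > 0` and `μ > 0`: for all small `ρ`, eventually in `N`, every Dirichlet trial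
state `Ψ` in the box of side `(N/ρ)^{1/3}` with `energy v Ψ ≤ E₀ + 1` has
`∫ |∇Ψ|² ≤ 4π a ρ (1 + μ) N` (drop the nonnegative interaction, then Dyson's upper bound
`E₀ ≤ 4πρa(1 + C(ρa³)^{1/3})N` with `C(ρa³)^{1/3} ≤ μ/2` and `1 ≤ 2πaρμN`).
[cite: LSSY2005, Thm. 2.2 (2.14)–(2.15)] -/
theorem stub_kineticBudget :
    ∀ v : ℝ → ℝ≥0∞, IsRepulsiveFiniteRange v → 0 < scatteringLength v → ∀ μ : ℝ, 0 < μ →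
      ∃ ρ₀ : ℝ, 0 < ρ₀ ∧ ∀ ρ : ℝ, 0 < ρ → ρ < ρ₀ → ∀ᶠ N : ℕ in atTop,
        ∀ Ψ : TrialState N (sideLength ρ N),
          energy v Ψ ≤ groundStateEnergy v N (sideLength ρ N) + 1 →
            ∫⁻ X, kineticDensity Ψ.ψ X ≤
              ENNReal.ofReal (4 * Real.pi * (scatteringLength v).toReal * ρ * (1 + μ) * N) := by
  intro v hv ha μ hμ
  obtain ⟨hvm, R₀, hR₀⟩ := hv
  have haT : scatteringLength v ≠ ⊤ :=
    IsRepulsiveFiniteRange.scatteringLength_ne_top ⟨hvm, R₀, hR₀⟩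
  obtain ⟨C, ρ₁, hC, hρ₁, H⟩ := eventually_groundStateEnergy_le_dyson hR₀ hvm haT ha
  set a : ℝ := (scatteringLength v).toReal with ha_def
  have ha0 : 0 < a := ENNReal.toReal_pos ha.ne' haT
  -- `t = μ/(2C)`: `ρ a³ ≤ t³` forces `C (ρa³)^{1/3} ≤ μ/2`
  set t : ℝ := μ / (2 * C) with ht
  have ht0 : 0 < t := by positivity
  refine ⟨min ρ₁ (t ^ 3 / a ^ 3), lt_min hρ₁ (by positivity), ?_⟩
  intro ρ hρ hρlt
  have hρ₁' : ρ < ρ₁ := hρlt.trans_le (min_le_left _ _)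
  have hρt : ρ < t ^ 3 / a ^ 3 := hρlt.trans_le (min_le_right _ _)
  have hK : 0 < 2 * Real.pi * a * ρ * μ := by positivity
  filter_upwards [H ρ hρ hρ₁', Filter.eventually_ge_atTop ⌈(2 * Real.pi * a * ρ * μ)⁻¹⌉₊]
    with N hN hN1
  intro Ψ hΨ
  -- the slack `1` is absorbed: `1 ≤ 2π a ρ μ N`
  have hN1' : (2 * Real.pi * a * ρ * μ)⁻¹ ≤ (N : ℝ) :=
    (Nat.le_ceil _).trans (by exact_mod_cast hN1)
  have hone : 1 ≤ 2 * Real.pi * a * ρ * μ * N := by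
    have h := mul_le_mul_of_nonneg_left hN1' hK.le
    rwa [mul_inv_cancel₀ hK.ne'] at h
  -- Dyson's correction is `≤ μ/2`
  have hY : C * (ρ * a ^ 3) ^ ((1 : ℝ) / 3) ≤ μ / 2 := by
    have h1 : (ρ * a ^ 3) ^ ((1 : ℝ) / 3) ≤ (t ^ 3) ^ ((1 : ℝ) / 3) := by
      refine Real.rpow_le_rpow (by positivity) ?_ (by norm_num)
      exact ((lt_div_iff₀ (by positivity : (0 : ℝ) < a ^ 3)).mp hρt).le
    rw [← Real.rpow_natCast t, ← Real.rpow_mul ht0.le,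
      show ((3 : ℕ) : ℝ) * (1 / 3) = 1 by norm_num, Real.rpow_one] at h1
    calc C * (ρ * a ^ 3) ^ ((1 : ℝ) / 3) ≤ C * t := by gcongr
      _ = μ / 2 := by rw [ht]; field_simp
  have hD0 : 0 ≤ 4 * Real.pi * ρ * a * (1 + C * (ρ * a ^ 3) ^ ((1 : ℝ) / 3)) * N := by positivity
  have hmain : 4 * Real.pi * ρ * a * (1 + C * (ρ * a ^ 3) ^ ((1 : ℝ) / 3)) * N + 1 ≤
      4 * Real.pi * a * ρ * (1 + μ) * N := by
    have h4 : (0 : ℝ) ≤ 4 * Real.pi * ρ * a * N := by positivity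
    nlinarith [mul_le_mul_of_nonneg_left hY h4, hone]
  calc ∫⁻ X, kineticDensity Ψ.ψ X ≤ energy v Ψ := lintegral_mono fun X => le_self_add
    _ ≤ groundStateEnergy v N (sideLength ρ N) + 1 := hΨ
    _ ≤ ENNReal.ofReal (4 * Real.pi * ρ * a * (1 + C * (ρ * a ^ 3) ^ ((1 : ℝ) / 3)) * N) + 1 :=
        add_le_add hN le_rfl
    _ = ENNReal.ofReal (4 * Real.pi * ρ * a * (1 + C * (ρ * a ^ 3) ^ ((1 : ℝ) / 3)) * N + 1) := by
        rw [ENNReal.ofReal_add hD0 zero_le_one, ENNReal.ofReal_one]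
    _ ≤ ENNReal.ofReal (4 * Real.pi * a * ρ * (1 + μ) * N) := ENNReal.ofReal_le_ofReal hmain

end Summit.AtomisticToContinuum.BoseEinsteinCondensation.Cruxes.DyadicCoherenceDefect.Birth

end
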